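import Summits.QuantumFields.YangMills.Theorems.BalabanUVNodesN06AtOpsYOfLettersB
import Summits.QuantumFields.YangMills.Theorems.BalabanUVNodesN06AtRecord11ObligationsPins4
import Literature.MathematicalPhysics.QuantumFieldTheory.Balaban1983to89.B9Ineq347GpAtLetters
import Literature.MathematicalPhysics.QuantumFieldTheory.Balaban1983to89.B9Thm313Whole
import Summits.QuantumFields.YangMills.Theorems.BalabanUVNodesN06AtRecord11ObligationsPins
import Summits.QuantumFields.YangMills.Theorems.BalabanUVNodesN06AtRecord11ObligationsPins2
import Literature.MathematicalPhysics.QuantumFieldTheory.Balaban1983to89.B9ResidualEntriesAtOne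
import Literature.MathematicalPhysics.QuantumFieldTheory.Balaban1983to89.B9Cor35ComparisonsGAAtLetters
import Literature.MathematicalPhysics.QuantumFieldTheory.Balaban1983to89.B9Cor35ComparisonsGpCAtLetters
import Literature.MathematicalPhysics.QuantumFieldTheory.Balaban1983to89.B9GeoLemma21KLevelV1
import Literature.MathematicalPhysics.QuantumFieldTheory.Balaban1983to89.B9Ineq347Reading

/-!
# BalabanUVNodes ∕ N06 ([B9], `Dag.B9_main`) — THE STAGE-11 CERTIFICATE AT def-Y's INSTANCE ON THE ALL-BLOCKS PINS (seat n06-k's route: `hsum` a projection, (3.46)₀₋₂ ∕ (3.47) proved)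

Track A of `YM-PLAN.md` (cell `pub-ymgap`, D-0062), node **N06** = [Balaban1985BackgroundPropagators] Thms 3.1–3.15; seat `pub-ymgap-dag-n06-d` gen 2 = N06-ASSIGNMENT v1 (P3).
Sibling of `BalabanUVNodesN06AtOpsYOfLettersB` (same instance; there the walk pins carry (3.42)-only convergence predicates and the (3.46)∕(3.47) residuals are displayed).  Here
the E-letters of Thms 3.7 ∕ 3.10 are pinned to n06-k's ALL-BLOCKS data `E37AllOfOps (W38OfOps …) … Gp B₁ δ₁ …`, `W310OfOps … (ConvAll3107 … GA B₁ δ₁ …)`: the summation leaf is the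
projection (`…Pins4.hsum_of_allPins`), Cor. 3.8 is unchanged (`c38_of_allPin`), and `t37`, `t310` are PROVED at those pins (`t37_of_allPin`, `t310_of_allPin`: (3.47)₀₋₃ by scale
transfer + [4] Lemma 2.1, (3.46)₀,₁,₂ by the Schur test, from the co-readings `CoRealizes`∕`GlobReads`∕`L2Reads`, the transpose pairs, `Facts347` for M ≧ M_g, and the residual
(3.43)–(3.45) + (3.46)₃,₄,₅ under the provisos) — INTERFACE-2∕2b of the bus resolved on n06-k's route.  BUILT by applying the ORIGINAL certificate
`N06AtRecord11CB10YZW.b9_main_of_up_view₁₁B10YZW_of_obligations` (p449575) at `ops := opsYOfLetters N θ M⋆ 𝔏 𝔈` with ALL 28 operator-layer binders supplied by lemma (rows 1–8: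
n06-f∕n06-g at the instance; 9–12: n06-h; 13–14: sequels V∕VII; t37 c38 t310 hsum: `…Pins4`; 15–17, 23–24, 26: `…Pins`∕`…Pins2`; 20–21: n06-l inline; 22: sequel III; 25: n06-i).
HONEST FRAMING.  def-Y's layer of LETTERS (U = 1 clauses), not Bałaban's constructed operators; every row supplied MODULO displayed hypothesis schemas of printed ∕ located shape;
nothing of [B9] proved for Bałaban's operators; k 0 ∕ 28; N06 NOT discharged.  One finite 𝕋⁴ programme at fixed `ε` — NOT ℝ⁴ ∕ OS ∕ mass gap ∕ Clay.  0 `def`, 0 `sorry`.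
-/

noncomputable section

namespace Summit.QuantumFields.YangMills.BalabanUVNodes.N06AtOpsYOfLettersAllPins

open Literature.MathematicalPhysics.QuantumFieldTheory.Balaban1983to89
open Literature.MathematicalPhysics.QuantumFieldTheory.Balaban1983to89.T4Continuum (T4Family FiniteEpsData)
open Literature.MathematicalPhysics.QuantumFieldTheory.Balaban1983to89.DagBinding (WorldP leavesP B9LeafX)
open Literature.MathematicalPhysics.QuantumFieldTheory.Balaban1983to89.Node00
open Literature.MathematicalPhysics.QuantumFieldTheory.Balaban1983to89.B9PinMembersKLevelV1 (MemberY geo9Y bg9Y)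
open Literature.MathematicalPhysics.QuantumFieldTheory.Balaban1983to89.B9PinGeometryKLevelV1 (dOmegaY OmKY inΛY unitDistY InCubeY c35Y c35Y_pos)
open Literature.MathematicalPhysics.QuantumFieldTheory.Balaban1983to89.B7Prop2SpecialUnitary (specialUnitaryUnits)
open Literature.MathematicalPhysics.QuantumFieldTheory.Balaban1983to89.B9Thm37Whole (Ops Conv342 Sizes StaticOK Local342 Identities const37)
open Literature.MathematicalPhysics.QuantumFieldTheory.Balaban1983to89.B9Cor38Whole (WalkReading Locality W38OfOps)
open Literature.MathematicalPhysics.QuantumFieldTheory.Balaban1983to89.B9Thm37GlueCor36 (CoRealizes)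
open Literature.MathematicalPhysics.QuantumFieldTheory.Balaban1983to89.B6RandomWalk (Ineq261)
open Literature.MathematicalPhysics.QuantumFieldTheory.Balaban1983to89.B9Thm34Ext (toB6)
open Literature.MathematicalPhysics.QuantumFieldTheory.Balaban1983to89.B9Thm314 (Thm314LocalPrinted IneqSupF)
open Literature.MathematicalPhysics.QuantumFieldTheory.Balaban1983to89.B9SectBStepWhole
  (StepE StepL2n StepGlob StepH1 StepE4 StepH2 StepKer StepAnalytic)
open Literature.MathematicalPhysics.QuantumFieldTheory.Balaban1983to89.B9Ineq349Whole (Dict349)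
open Literature.MathematicalPhysics.QuantumFieldTheory.Balaban1983to89.B9Eq3132Whole (CTInputs InvNormalised WeightsTransfer)
open Literature.MathematicalPhysics.QuantumFieldTheory.Balaban1983to89.B9ResidualEntriesAtOne (AtOneL2On AtOneGlobOn AtOneH1On AtOneE4On AtOneH2On)
open Literature.MathematicalPhysics.QuantumFieldTheory.Balaban1983to89.B9Thm39Whole
  (Ops39 WalkReading39 EK39OfOps StaticOK39 Local348 Identities395 Small285 Factors389 Locality39 KerReads)
open Literature.MathematicalPhysics.QuantumFieldTheory.Balaban1983to89.B9Thm311Whole (Ops311 PosDefOfOps Inputs311)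
open Literature.MathematicalPhysics.QuantumFieldTheory.Balaban1983to89.B9Thm310Whole
  (Ops310 WalkReading310 Sizes310 StaticOK310 Locality310 Local342G Identities310 W310OfOps Conv3107)
open Literature.MathematicalPhysics.QuantumFieldTheory.Balaban1983to89.B9Thm315Whole (Ops315 Reads315 Static315 GivenBy3185OfOps HasRWExpCOfOps)
open Literature.MathematicalPhysics.QuantumFieldTheory.Balaban1983to89.B9Thm314Whole (DiffExpansionAllNorms RWSumFactorYieldsSupL2 RWSumFactorYieldsHolder)
open Literature.MathematicalPhysics.QuantumFieldTheory.Balaban1983to89.B9Ineq347Reading (GlobReading AtOneEOn Lemma21Above atOneGlobOn_of_atOneEOn)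
open Literature.MathematicalPhysics.QuantumFieldTheory.Balaban1983to89.B9GeoLemma21KLevelV1
  (distOK_geo9Y levelGap_geo9Y_one rowSum261_geo9Y geo9Y_dist_triangle geo9Y_dist_comm geo9Y_len_pos)
open Literature.MathematicalPhysics.QuantumFieldTheory.Balaban1983to89.B9GeoNormsKLevelModelSignsV1 (modelSignsOn_geo9K)
open Summit.QuantumFields.YangMills.BalabanUVNodes.N06AtRecord11ObligationsPins (t311_of_pin t314loc_of_leaves t315_of_pins)
open Literature.MathematicalPhysics.QuantumFieldTheory.Balaban1983to89.B9ResidualEntriesAtOne (hGp_of_blocksOn_of_null hGA_of_globOn_of_null)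
open Literature.MathematicalPhysics.QuantumFieldTheory.Balaban1983to89.B9Cor35ComparisonsGAAtLetters
  (hGA_e_opsYOfLetters hGA_h1_opsYOfLetters hGA_e4_opsYOfLetters hGA_h2_opsYOfLetters hGA_l2_opsYOfLetters hnullGA_opsYOfLetters)
open Literature.MathematicalPhysics.QuantumFieldTheory.Balaban1983to89.B9Cor35ComparisonsGpCAtLetters (hGp_e_opsYOfLetters hGp_h1_opsYOfLetters hC_opsYOfLetters)
open Summit.QuantumFields.YangMills.BalabanUVNodes.N06AtRecord11ObligationsPins2 (t39_of_pin hksum_of_pin s3132_of_inputs)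
open Literature.MathematicalPhysics.QuantumFieldTheory.Balaban1983to89.B9Thm312Whole (GeoOK Thm33G0 FormSmall HasRWExpOfOps HasRWExpHOfOps PosDefKOfOps)
open Literature.MathematicalPhysics.QuantumFieldTheory.Balaban1983to89.B11SectG (RowSum)
open Literature.MathematicalPhysics.QuantumFieldTheory.Balaban1983to89.B9FromB6 (L2Block)
open Literature.MathematicalPhysics.QuantumFieldTheory.Balaban1983to89.B9Thm37GlueCor36 (Clause342)
open Literature.MathematicalPhysics.QuantumFieldTheory.Balaban1983to89.B9Thm312WholeLeaf (thm312Printed_of_step)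
open Literature.MathematicalPhysics.QuantumFieldTheory.Balaban1983to89.B9Thm313Whole (Letters313 thm313Printed_of_step)
open Literature.MathematicalPhysics.QuantumFieldTheory.Balaban1983to89.B9GeoNormsKLevelV1 (geo9K_dist_nonneg)
open Literature.MathematicalPhysics.QuantumFieldTheory.Balaban1983to89.B9Thm37Glue (IsTransposePair)
open Literature.MathematicalPhysics.QuantumFieldTheory.Balaban1983to89.B9RWSums343to347Whole (GlobReads Facts347 ConvAll3107 E37AllOfOps)
open Literature.MathematicalPhysics.QuantumFieldTheory.Balaban1983to89.B9RWSums346Schur (L2Reads)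
open Literature.MathematicalPhysics.QuantumFieldTheory.Balaban1983to89.B9Cor35ComparisonsEH (hE4_of_hGA_e4 hH2_of_hGA_h2)
open Literature.MathematicalPhysics.QuantumFieldTheory.Balaban1983to89.B9Ineq349Whole (stmt349Printed_of_thm31_thm32)
open Summit.QuantumFields.YangMills.BalabanUVNodes.N06AtRecord11ObligationsT314 (t314_obligation_of_t314loc)
open Summit.QuantumFields.YangMills.BalabanUVNodes.N06AtRecord11ObligationsSectBn (hB_obligation_of_memberSteps)
open Summit.QuantumFields.YangMills.BalabanUVNodes.N06AtRecord11ObligationsHg (hg_obligation_vacuous)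
open Summit.QuantumFields.YangMills.BalabanUVNodes.N06AtRecord11ObligationsPins4 (t37_of_allPin c38_of_allPin t310_of_allPin hsum_of_allPins)
open Literature.MathematicalPhysics.QuantumFieldTheory.Balaban1983to89.B9Ineq347GpAtLetters (atOneGlobOn_Gp_opsYOfLetters)
open Summit.QuantumFields.YangMills.BalabanUVNodes.N06AtRecord11CB10YZW (b9_main_of_up_view₁₁B10YZW_of_obligations)
open scoped Matrix.Norms.L2Operator

variable {N : ℕ}

section Pointed

variable [NeZero N] {F : T4Family}

/-- **THE STAGE-11 CERTIFICATE AT def-Y's INSTANCE ON THE ALL-BLOCKS PINS** (module docstring): `Dag.B9_main` at every run of a world bound over the four-pin Stage-11 view of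
`(θ, M⋆, opsYOfLetters N θ M⋆ 𝔏 𝔈, ζ, λ_W)`, every `𝔏 𝔈`, all 28 operator-layer obligations of p449575 supplied by lemma; `hsum` a projection, (3.46)₀₋₂ ∕ (3.47) proved.  NOT a discharge
of N06. [cite: Balaban1985BackgroundPropagators, Thms 3.1–3.15 pp.397–432, Cor. 3.5 p.407, pp.410, 416; Balaban1984PropagatorsII, Props. 2.2–2.6 pp.234–247, Lemma 2.1 pp.233–234] -/
theorem b9_main_of_up_view₁₁B10YZW_opsYOfLetters_allPins (θ : Stage11Params F N) (hθ : θ.Admissible) (Mstar : ℕ)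
    (𝔏 : LettersY N θ.toStage3Params Mstar) (𝔈 : ExpsY N θ.toStage3Params Mstar) (ζ : ResidZ F N) (lamW : ResidW F N) (w : WorldP)
    (hup : ∀ P, w.up P = upOfRecord₅C F N (θ.view₁₁B10YZW F N Mstar (opsYOfLetters N θ.toStage3Params Mstar 𝔏 𝔈) ζ lamW) P)
    (hA : StepAnalytic (θ.d₆ + 1) c35Y geo9Y (bg9Y (Matrix (Fin N) (Fin N) ℂ) (specialUnitaryUnits (Fin N))) (fun x => ((opsYOfLetters N θ.toStage3Params Mstar 𝔏 𝔈) x).Gp) (fun x => ((opsYOfLetters N θ.toStage3Params Mstar 𝔏 𝔈) x).GA)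
      (fun x => ((opsYOfLetters N θ.toStage3Params Mstar 𝔏 𝔈) x).Cinv) (fun x => ((opsYOfLetters N θ.toStage3Params Mstar 𝔏 𝔈) x).IsAnalyticExt))
    (hEp : StepE (θ.d₆ + 1) c35Y geo9Y (bg9Y (Matrix (Fin N) (Fin N) ℂ) (specialUnitaryUnits (Fin N))) (fun x => ((opsYOfLetters N θ.toStage3Params Mstar 𝔏 𝔈) x).Gp) (fun x => ((opsYOfLetters N θ.toStage3Params Mstar 𝔏 𝔈) x).GA)
      (fun x => ((opsYOfLetters N θ.toStage3Params Mstar 𝔏 𝔈) x).Cinv) (fun x => ((opsYOfLetters N θ.toStage3Params Mstar 𝔏 𝔈) x).Gp))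
    (hLp : ∀ n : Fin 6, StepL2n (θ.d₆ + 1) c35Y geo9Y (bg9Y (Matrix (Fin N) (Fin N) ℂ) (specialUnitaryUnits (Fin N))) (fun x => ((opsYOfLetters N θ.toStage3Params Mstar 𝔏 𝔈) x).Gp) (fun x => ((opsYOfLetters N θ.toStage3Params Mstar 𝔏 𝔈) x).GA)
      (fun x => ((opsYOfLetters N θ.toStage3Params Mstar 𝔏 𝔈) x).Cinv) (fun x => ((opsYOfLetters N θ.toStage3Params Mstar 𝔏 𝔈) x).Gp) n)
    (hGlp : StepGlob (θ.d₆ + 1) c35Y geo9Y (bg9Y (Matrix (Fin N) (Fin N) ℂ) (specialUnitaryUnits (Fin N))) (fun x => ((opsYOfLetters N θ.toStage3Params Mstar 𝔏 𝔈) x).Gp) (fun x => ((opsYOfLetters N θ.toStage3Params Mstar 𝔏 𝔈) x).GA)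
      (fun x => ((opsYOfLetters N θ.toStage3Params Mstar 𝔏 𝔈) x).Cinv) (fun x => ((opsYOfLetters N θ.toStage3Params Mstar 𝔏 𝔈) x).Gp))
    (hH1p : StepH1 (θ.d₆ + 1) c35Y geo9Y (bg9Y (Matrix (Fin N) (Fin N) ℂ) (specialUnitaryUnits (Fin N))) (fun x => ((opsYOfLetters N θ.toStage3Params Mstar 𝔏 𝔈) x).Gp) (fun x => ((opsYOfLetters N θ.toStage3Params Mstar 𝔏 𝔈) x).GA)
      (fun x => ((opsYOfLetters N θ.toStage3Params Mstar 𝔏 𝔈) x).Cinv) (fun x => ((opsYOfLetters N θ.toStage3Params Mstar 𝔏 𝔈) x).Gp))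
    (hE4p : StepE4 (θ.d₆ + 1) c35Y geo9Y (bg9Y (Matrix (Fin N) (Fin N) ℂ) (specialUnitaryUnits (Fin N))) (fun x => ((opsYOfLetters N θ.toStage3Params Mstar 𝔏 𝔈) x).Gp) (fun x => ((opsYOfLetters N θ.toStage3Params Mstar 𝔏 𝔈) x).GA)
      (fun x => ((opsYOfLetters N θ.toStage3Params Mstar 𝔏 𝔈) x).Cinv) (fun x => ((opsYOfLetters N θ.toStage3Params Mstar 𝔏 𝔈) x).Gp))
    (hH2p : StepH2 (θ.d₆ + 1) c35Y geo9Y (bg9Y (Matrix (Fin N) (Fin N) ℂ) (specialUnitaryUnits (Fin N))) (fun x => ((opsYOfLetters N θ.toStage3Params Mstar 𝔏 𝔈) x).Gp) (fun x => ((opsYOfLetters N θ.toStage3Params Mstar 𝔏 𝔈) x).GA)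
      (fun x => ((opsYOfLetters N θ.toStage3Params Mstar 𝔏 𝔈) x).Cinv) (fun x => ((opsYOfLetters N θ.toStage3Params Mstar 𝔏 𝔈) x).Gp))
    (hK : StepKer (θ.d₆ + 1) c35Y geo9Y (bg9Y (Matrix (Fin N) (Fin N) ℂ) (specialUnitaryUnits (Fin N))) (fun x => ((opsYOfLetters N θ.toStage3Params Mstar 𝔏 𝔈) x).Gp) (fun x => ((opsYOfLetters N θ.toStage3Params Mstar 𝔏 𝔈) x).GA)
      (fun x => ((opsYOfLetters N θ.toStage3Params Mstar 𝔏 𝔈) x).Cinv) (fun x => ((opsYOfLetters N θ.toStage3Params Mstar 𝔏 𝔈) x).Cinv))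
    (hEa : StepE (θ.d₆ + 1) c35Y geo9Y (bg9Y (Matrix (Fin N) (Fin N) ℂ) (specialUnitaryUnits (Fin N))) (fun x => ((opsYOfLetters N θ.toStage3Params Mstar 𝔏 𝔈) x).Gp) (fun x => ((opsYOfLetters N θ.toStage3Params Mstar 𝔏 𝔈) x).GA)
      (fun x => ((opsYOfLetters N θ.toStage3Params Mstar 𝔏 𝔈) x).Cinv) (fun x => ((opsYOfLetters N θ.toStage3Params Mstar 𝔏 𝔈) x).GA))
    (hLa : ∀ n : Fin 6, StepL2n (θ.d₆ + 1) c35Y geo9Y (bg9Y (Matrix (Fin N) (Fin N) ℂ) (specialUnitaryUnits (Fin N))) (fun x => ((opsYOfLetters N θ.toStage3Params Mstar 𝔏 𝔈) x).Gp) (fun x => ((opsYOfLetters N θ.toStage3Params Mstar 𝔏 𝔈) x).GA)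
      (fun x => ((opsYOfLetters N θ.toStage3Params Mstar 𝔏 𝔈) x).Cinv) (fun x => ((opsYOfLetters N θ.toStage3Params Mstar 𝔏 𝔈) x).GA) n)
    (hGla : StepGlob (θ.d₆ + 1) c35Y geo9Y (bg9Y (Matrix (Fin N) (Fin N) ℂ) (specialUnitaryUnits (Fin N))) (fun x => ((opsYOfLetters N θ.toStage3Params Mstar 𝔏 𝔈) x).Gp) (fun x => ((opsYOfLetters N θ.toStage3Params Mstar 𝔏 𝔈) x).GA)
      (fun x => ((opsYOfLetters N θ.toStage3Params Mstar 𝔏 𝔈) x).Cinv) (fun x => ((opsYOfLetters N θ.toStage3Params Mstar 𝔏 𝔈) x).GA))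
    (hH1a : StepH1 (θ.d₆ + 1) c35Y geo9Y (bg9Y (Matrix (Fin N) (Fin N) ℂ) (specialUnitaryUnits (Fin N))) (fun x => ((opsYOfLetters N θ.toStage3Params Mstar 𝔏 𝔈) x).Gp) (fun x => ((opsYOfLetters N θ.toStage3Params Mstar 𝔏 𝔈) x).GA)
      (fun x => ((opsYOfLetters N θ.toStage3Params Mstar 𝔏 𝔈) x).Cinv) (fun x => ((opsYOfLetters N θ.toStage3Params Mstar 𝔏 𝔈) x).GA))
    (hE4a : StepE4 (θ.d₆ + 1) c35Y geo9Y (bg9Y (Matrix (Fin N) (Fin N) ℂ) (specialUnitaryUnits (Fin N))) (fun x => ((opsYOfLetters N θ.toStage3Params Mstar 𝔏 𝔈) x).Gp) (fun x => ((opsYOfLetters N θ.toStage3Params Mstar 𝔏 𝔈) x).GA)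
      (fun x => ((opsYOfLetters N θ.toStage3Params Mstar 𝔏 𝔈) x).Cinv) (fun x => ((opsYOfLetters N θ.toStage3Params Mstar 𝔏 𝔈) x).GA))
    (hH2a : StepH2 (θ.d₆ + 1) c35Y geo9Y (bg9Y (Matrix (Fin N) (Fin N) ℂ) (specialUnitaryUnits (Fin N))) (fun x => ((opsYOfLetters N θ.toStage3Params Mstar 𝔏 𝔈) x).Gp) (fun x => ((opsYOfLetters N θ.toStage3Params Mstar 𝔏 𝔈) x).GA)
      (fun x => ((opsYOfLetters N θ.toStage3Params Mstar 𝔏 𝔈) x).Cinv) (fun x => ((opsYOfLetters N θ.toStage3Params Mstar 𝔏 𝔈) x).GA))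
    [∀ x : MemberY θ.d₆ θ.ℓ₆ θ.hd' θ.hL' θ.b₀ θ.b₁ Mstar, Fintype (geo9Y x).Site] [∀ x : MemberY θ.d₆ θ.ℓ₆ θ.hd' θ.hL' θ.b₀ θ.b₁ Mstar, DecidableEq (geo9Y x).Site]
    {X Y ι : MemberY θ.d₆ θ.ℓ₆ θ.hd' θ.hL' θ.b₀ θ.b₁ Mstar → Type}
    [∀ x, Fintype (X x)] [∀ x, DecidableEq (X x)] [∀ x, Fintype (Y x)] [∀ x, DecidableEq (Y x)] [∀ x, Fintype (ι x)]
    (hGpL2 : AtOneL2On geo9Y (bg9Y (Matrix (Fin N) (Fin N) ℂ) (specialUnitaryUnits (Fin N))) (fun x => ((opsYOfLetters N θ.toStage3Params Mstar 𝔏 𝔈) x).Gp) (fun _ lam => ¬ (lam.isRight = true)))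
    (hGpH1 : AtOneH1On geo9Y (bg9Y (Matrix (Fin N) (Fin N) ℂ) (specialUnitaryUnits (Fin N))) (fun x => ((opsYOfLetters N θ.toStage3Params Mstar 𝔏 𝔈) x).Gp) (fun _ lam => ¬ (lam.isRight = true)))
    (hGpE4 : AtOneE4On geo9Y (bg9Y (Matrix (Fin N) (Fin N) ℂ) (specialUnitaryUnits (Fin N))) (fun x => ((opsYOfLetters N θ.toStage3Params Mstar 𝔏 𝔈) x).Gp) (fun _ lam => ¬ (lam.isRight = true)))
    (hGpH2 : AtOneH2On geo9Y (bg9Y (Matrix (Fin N) (Fin N) ℂ) (specialUnitaryUnits (Fin N))) (fun x => ((opsYOfLetters N θ.toStage3Params Mstar 𝔏 𝔈) x).Gp) (fun _ lam => ¬ (lam.isRight = true)))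
    {resA : ∀ x : MemberY θ.d₆ θ.ℓ₆ θ.hd' θ.hL' θ.b₀ θ.b₁ Mstar, (geo9Y x).Site → (geo9Y x).Loc → (geo9Y x).Loc}
    (hRGA : ∀ x : MemberY θ.d₆ θ.ℓ₆ θ.hd' θ.hL' θ.b₀ θ.b₁ Mstar, GlobReading ((opsYOfLetters N θ.toStage3Params Mstar 𝔏 𝔈) x).GA (fun lam => lam.isRight = true) (bg9Y (Matrix (Fin N) (Fin N) ℂ) (specialUnitaryUnits (Fin N)) x).one (resA x))
    {d21 : ℕ} {R21 : MemberY θ.d₆ θ.ℓ₆ θ.hd' θ.hL' θ.b₀ θ.b₁ Mstar → ℝ} {H21 : MemberY θ.d₆ θ.ℓ₆ θ.hd' θ.hL' θ.b₀ θ.b₁ Mstar → Prop} {α21 : ℝ}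
    (hL21 : ∀ δ' : ℝ, 0 < δ' → ∃ ML' : ℝ,
      Lemma21Above d21 (geo9Y (d := θ.d₆) (ℓ := θ.ℓ₆) (hd := θ.hd') (hL := θ.hL') (b₀ := θ.b₀) (b₁ := θ.b₁) (Mstar := Mstar)) R21 H21 δ' α21 ML')
    (hEGA : AtOneEOn geo9Y (bg9Y (Matrix (Fin N) (Fin N) ℂ) (specialUnitaryUnits (Fin N))) (fun x => ((opsYOfLetters N θ.toStage3Params Mstar 𝔏 𝔈) x).GA) (fun _ lam => lam.isRight = true))
    {ι39 κ39 : MemberY θ.d₆ θ.ℓ₆ θ.hd' θ.hL' θ.b₀ θ.b₁ Mstar → Type} [∀ x, Fintype (ι39 x)]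
    (𝔬39 : ∀ x : MemberY θ.d₆ θ.ℓ₆ θ.hd' θ.hL' θ.b₀ θ.b₁ Mstar, Ops39 (geo9Y x) (bg9Y (Matrix (Fin N) (Fin N) ℂ) (specialUnitaryUnits (Fin N)) x) (ι39 x) (κ39 x))
    (rd39 : ∀ x : MemberY θ.d₆ θ.ℓ₆ θ.hd' θ.hL' θ.b₀ θ.b₁ Mstar, WalkReading39 (bg9Y (Matrix (Fin N) (Fin N) ℂ) (specialUnitaryUnits (Fin N)) x) (ι39 x) (κ39 x))
    (R39 : MemberY θ.d₆ θ.ℓ₆ θ.hd' θ.hL' θ.b₀ θ.b₁ Mstar → ℝ) (H39 : MemberY θ.d₆ θ.ℓ₆ θ.hd' θ.hL' θ.b₀ θ.b₁ Mstar → Prop) (α39 α' r39 δ39 θ39 B39 N39 a39 M39 ML39 : ℝ)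
    (h39α : 0 ≤ α39) (h39α1 : α39 < 1) (hα' : α' ≤ 1) (hr39 : 0 ≤ r39) (hrδ39 : r39 ≤ δ39) (hδ39 : 0 < δ39) (hθ39 : 0 ≤ θ39)
    (hB39 : 0 < B39) (hN39 : 0 ≤ N39) (ha39 : 0 < a39) (hM39 : 0 < M39) (hst39 : ∀ x, StaticOK39 (𝔬39 x) N39) (hloc39 : ∀ x, Locality39 (𝔬39 x) (rd39 x))
    (h261_39 : ∀ x : MemberY θ.d₆ θ.ℓ₆ θ.hd' θ.hL' θ.b₀ θ.b₁ Mstar, ML39 ≤ (geo9Y x).M →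
      Ineq261 (θ.d₆ + 1) (toB6 (geo9Y x) (R39 x) (H39 x)) δ39 α39 ∧ Ineq261 (θ.d₆ + 1) (toB6 (geo9Y x) (R39 x) (H39 x)) r39 α')
    (h39 : ∀ x : MemberY θ.d₆ θ.ℓ₆ θ.hd' θ.hL' θ.b₀ θ.b₁ Mstar, M39 ≤ (geo9Y x).M → ∀ α₀ : ℝ, 0 < α₀ → c35Y * (geo9Y x).M * α₀ ≤ a39 →
      ∀ U : (bg9Y (Matrix (Fin N) (Fin N) ℂ) (specialUnitaryUnits (Fin N)) x).Cfg, (bg9Y (Matrix (Fin N) (Fin N) ℂ) (specialUnitaryUnits (Fin N)) x).Reg335 c35Y α₀ U →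
        Local348 (𝔬39 x) (θ.d₆ + 1) B39 δ39 U ∧ Identities395 (𝔬39 x) U ∧ Small285 (𝔬39 x) (θ.d₆ + 1) θ39 r39 U ∧
          Factors389 (𝔬39 x) (θ.d₆ + 1) θ39 δ39 U)
    (hEK39 : ∀ x : MemberY θ.d₆ θ.ℓ₆ θ.hd' θ.hL' θ.b₀ θ.b₁ Mstar, ((opsYOfLetters N θ.toStage3Params Mstar 𝔏 𝔈) x).EK39 = EK39OfOps (𝔬39 x) (rd39 x) (θ.d₆ + 1) (2 * (N39 * B39) * B6.c1 (θ.d₆ + 1) r39 α') ((1 - α') * r39))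
    (hB₁39 : 0 < 2 * (N39 * B39) * B6.c1 (θ.d₆ + 1) r39 α') (hδ₁39 : 0 < (1 - α') * r39)
    (hrdC : ∀ x : MemberY θ.d₆ θ.ℓ₆ θ.hd' θ.hL' θ.b₀ θ.b₁ Mstar, KerReads (𝔬39 x) ((opsYOfLetters N θ.toStage3Params Mstar 𝔏 𝔈) x).Cinv (θ.d₆ + 1))
    {S32 S32₁ : ∀ x : MemberY θ.d₆ θ.ℓ₆ θ.hd' θ.hL' θ.b₀ θ.b₁ Mstar, (bg9Y (Matrix (Fin N) (Fin N) ℂ) (specialUnitaryUnits (Fin N)) x).Cfg → Matrix (geo9Y x).Site (geo9Y x).Site ℝ}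
    {w32 w32₁ : ∀ x : MemberY θ.d₆ θ.ℓ₆ θ.hd' θ.hL' θ.b₀ θ.b₁ Mstar, (geo9Y x).Site → ℝ}
    (hCT : CTInputs c35Y geo9Y (bg9Y (Matrix (Fin N) (Fin N) ℂ) (specialUnitaryUnits (Fin N))) S32) (hCT₁ : CTInputs c35Y geo9Y (bg9Y (Matrix (Fin N) (Fin N) ℂ) (specialUnitaryUnits (Fin N))) S32₁)
    (hN32 : ∀ x : MemberY θ.d₆ θ.ℓ₆ θ.hd' θ.hL' θ.b₀ θ.b₁ Mstar, InvNormalised ((opsYOfLetters N θ.toStage3Params Mstar 𝔏 𝔈) x).QGQinv (S32 x) (w32 x)) (hN32₁ : ∀ x : MemberY θ.d₆ θ.ℓ₆ θ.hd' θ.hL' θ.b₀ θ.b₁ Mstar, InvNormalised ((opsYOfLetters N θ.toStage3Params Mstar 𝔏 𝔈) x).QG1Qinv (S32₁ x) (w32₁ x))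
    {A32 : ℝ} (hA32 : 0 < A32)
    (hwt : ∀ ε : ℝ, 0 < ε → ∃ Mw : ℝ, ∀ x : MemberY θ.d₆ θ.ℓ₆ θ.hd' θ.hL' θ.b₀ θ.b₁ Mstar, Mw ≤ (geo9Y x).M →
      WeightsTransfer (geo9Y x) (θ.d₆ + 1) (w32 x) ε A32 ∧ WeightsTransfer (geo9Y x) (θ.d₆ + 1) (w32₁ x) ε A32)
    (𝔬 : ∀ x, Ops (geo9Y x) (bg9Y (Matrix (Fin N) (Fin N) ℂ) (specialUnitaryUnits (Fin N)) x) (X x) (Y x) (ι x))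
    (rd : ∀ x, WalkReading (geo9Y x) (bg9Y (Matrix (Fin N) (Fin N) ℂ) (specialUnitaryUnits (Fin N)) x) (X x) (ι x))
    (R : MemberY θ.d₆ θ.ℓ₆ θ.hd' θ.hL' θ.b₀ θ.b₁ Mstar → ℝ) (H : MemberY θ.d₆ θ.ℓ₆ θ.hd' θ.hL' θ.b₀ θ.b₁ Mstar → Prop)
    (κ : MemberY θ.d₆ θ.ℓ₆ θ.hd' θ.hL' θ.b₀ θ.b₁ Mstar → Sizes) (d : ℕ) (α ρ Nc N' Cℓ K θ₀ B₀ δ₀ a₁ M₁ ML : ℝ)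
    (hα : 0 ≤ α) (hα2 : α ≤ 1 / 2) (hN : 0 ≤ Nc) (hN' : 0 ≤ N') (hCℓ : 1 ≤ Cℓ) (hK0 : 0 ≤ K) (hθ₀ : 0 ≤ θ₀) (hB₀ : 0 < B₀) (hδ₀ : 0 < δ₀) (ha₁ : 0 < a₁) (hM₁ : 0 < M₁)
    (hst : ∀ x, StaticOK (𝔬 x) ρ Nc N' Cℓ (κ x)) (hκ : ∀ x, (κ x).Bounded K θ₀ Cℓ (geo9Y x).M) (hrd : ∀ x, (rd x).OK (𝔬 x).blk) (hloc : ∀ x, Locality (𝔬 x) (rd x))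
    (h261 : ∀ x, ML ≤ (geo9Y x).M → Ineq261 d (toB6 (geo9Y x) (R x) (H x)) δ₀ α)
    (h36 : ∀ x, M₁ ≤ (geo9Y x).M → ∀ α₀ : ℝ, 0 < α₀ → c35Y * (geo9Y x).M * α₀ ≤ a₁ →
      ∀ U : (bg9Y (Matrix (Fin N) (Fin N) ℂ) (specialUnitaryUnits (Fin N)) x).Cfg,
        (bg9Y (Matrix (Fin N) (Fin N) ℂ) (specialUnitaryUnits (Fin N)) x).Reg335 c35Y α₀ U →
          Local342 (𝔬 x) (R x) (H x) B₀ δ₀ U ∧ Identities (𝔬 x) (R x) (H x) U)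
    (evY : ∀ x : MemberY θ.d₆ θ.ℓ₆ θ.hd' θ.hL' θ.b₀ θ.b₁ Mstar, (geo9Y x).Loc → Y x → ℝ)
    (hco0 : ∀ x U, CoRealizes ((opsYOfLetters N θ.toStage3Params Mstar 𝔏 𝔈) x).Gp 0 U (𝔬 x).blk (𝔬 x).blk (rd x).ev ((𝔬 x).Gp U))
    (hco1 : ∀ x U, CoRealizes ((opsYOfLetters N θ.toStage3Params Mstar 𝔏 𝔈) x).Gp 1 U (𝔬 x).blkY (𝔬 x).blk (rd x).ev ((𝔬 x).D U ∘ₗ (𝔬 x).Gp U))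
    (hco2 : ∀ x U, CoRealizes ((opsYOfLetters N θ.toStage3Params Mstar 𝔏 𝔈) x).Gp 2 U (𝔬 x).blk (𝔬 x).blkY (evY x) ((𝔬 x).Gp U ∘ₗ (𝔬 x).Dstar U))
    (hco3 : ∀ x U, CoRealizes ((opsYOfLetters N θ.toStage3Params Mstar 𝔏 𝔈) x).Gp 3 U (𝔬 x).blk (𝔬 x).blk (rd x).ev ((𝔬 x).Lap U ∘ₗ (𝔬 x).Gp U))
    {B₁ δ₁ : ℝ} (hB₁ : 0 < B₁) (hδ₁ : 0 < δ₁) {Bβ Bε : ℝ → ℝ} {Bεβ : ℝ → ℝ → ℝ}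
    (hgl0 : ∀ x U, GlobReads ((opsYOfLetters N θ.toStage3Params Mstar 𝔏 𝔈) x).Gp 0 U (𝔬 x).blk (𝔬 x).blk (rd x).ev ((𝔬 x).Gp U))
    (hgl1 : ∀ x U, GlobReads ((opsYOfLetters N θ.toStage3Params Mstar 𝔏 𝔈) x).Gp 1 U (𝔬 x).blkY (𝔬 x).blk (rd x).ev ((𝔬 x).D U ∘ₗ (𝔬 x).Gp U))
    (hgl2 : ∀ x U, GlobReads ((opsYOfLetters N θ.toStage3Params Mstar 𝔏 𝔈) x).Gp 2 U (𝔬 x).blk (𝔬 x).blkY (evY x) ((𝔬 x).Gp U ∘ₗ (𝔬 x).Dstar U))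
    (hgl3 : ∀ x U, GlobReads ((opsYOfLetters N θ.toStage3Params Mstar 𝔏 𝔈) x).Gp 3 U (𝔬 x).blk (𝔬 x).blk (rd x).ev ((𝔬 x).Lap U ∘ₗ (𝔬 x).Gp U))
    (hl0 : ∀ x U, L2Reads (R := R x) (H := H x) ((opsYOfLetters N θ.toStage3Params Mstar 𝔏 𝔈) x).Gp 0 U (𝔬 x).blk (𝔬 x).blk (rd x).ev ((𝔬 x).Gp U))
    (hl1 : ∀ x U, L2Reads (R := R x) (H := H x) ((opsYOfLetters N θ.toStage3Params Mstar 𝔏 𝔈) x).Gp 1 U (𝔬 x).blkY (𝔬 x).blk (rd x).ev ((𝔬 x).D U ∘ₗ (𝔬 x).Gp U))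
    (hl2 : ∀ x U, L2Reads (R := R x) (H := H x) ((opsYOfLetters N θ.toStage3Params Mstar 𝔏 𝔈) x).Gp 2 U (𝔬 x).blk (𝔬 x).blkY (evY x) ((𝔬 x).Gp U ∘ₗ (𝔬 x).Dstar U))
    (hsym : ∀ x U, IsTransposePair ((𝔬 x).Gp U) ((𝔬 x).Gp U)) (htr : ∀ x U, IsTransposePair ((𝔬 x).D U ∘ₗ (𝔬 x).Gp U) ((𝔬 x).Gp U ∘ₗ (𝔬 x).Dstar U))
    {dF : ℕ} {αF L₀ Mg Mr ar : ℝ} (hfacts : ∀ x : MemberY θ.d₆ θ.ℓ₆ θ.hd' θ.hL' θ.b₀ θ.b₁ Mstar, Mg ≤ (geo9Y x).M → Facts347 (geo9Y x) (R x) (H x) dF ((1 - 2 * α) * δ₀) αF L₀)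
    (hCB : (const37 d δ₀ α ρ B₀ Nc N' Cℓ K) ≤ B₁) (hCL : (const37 d δ₀ α ρ B₀ Nc N' Cℓ K) * L₀ ≤ B₁) (hδ₁le : δ₁ ≤ (1 - αF) * ((1 - 2 * α) * δ₀)) (hαF : 0 ≤ αF * ((1 - 2 * α) * δ₀))
    (hCg : (const37 d δ₀ α ρ B₀ Nc N' Cℓ K) * B6.c1 dF ((1 - 2 * α) * δ₀) (1 - αF) * L₀ ^ (4 : ℝ) ≤ B₁) (har : 0 < ar)
    (hrest : ∀ x : MemberY θ.d₆ θ.ℓ₆ θ.hd' θ.hL' θ.b₀ θ.b₁ Mstar, Mr ≤ (geo9Y x).M → ∀ α₀ : ℝ, 0 < α₀ → (geo9Y x).M * α₀ ≤ ar → ∀ U : (bg9Y (Matrix (Fin N) (Fin N) ℂ) (specialUnitaryUnits (Fin N)) x).Cfg, (bg9Y (Matrix (Fin N) (Fin N) ℂ) (specialUnitaryUnits (Fin N)) x).Reg335 c35Y α₀ U →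
      B9.Ineq343_345 ((opsYOfLetters N θ.toStage3Params Mstar 𝔏 𝔈) x).Gp Bβ Bε Bεβ δ₁ U ∧
        ∀ (n : Fin 6), 3 ≤ n.val → ∀ (lam : (geo9Y x).Loc) (h : (geo9Y x).Cut) (y y' : (geo9Y x).Site), (geo9Y x).cutIn h y →
          (geo9Y x).suppIn lam y' →
          ((opsYOfLetters N θ.toStage3Params Mstar 𝔏 𝔈) x).Gp.l2 n U lam h ≤ B₁ * B9.pref6 ((geo9Y x).len y) n * (geo9Y x).cutSup h *
            Real.exp (-(δ₁ * (geo9Y x).dist y y')) * (geo9Y x).l2Norm lam)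
    (hE37 : ∀ x : MemberY θ.d₆ θ.ℓ₆ θ.hd' θ.hL' θ.b₀ θ.b₁ Mstar, ((opsYOfLetters N θ.toStage3Params Mstar 𝔏 𝔈) x).E37 = E37AllOfOps (W38OfOps (𝔬 x) (rd x) (R x) (H x) (const37 d δ₀ α ρ B₀ Nc N' Cℓ K) ((1 - 2 * α) * δ₀)) (𝔬 x) (R x) (H x) (const37 d δ₀ α ρ B₀ Nc N' Cℓ K) ((1 - 2 * α) * δ₀) ((opsYOfLetters N θ.toStage3Params Mstar 𝔏 𝔈) x).Gp B₁ δ₁ Bβ Bε Bεβ)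
    {E7 F7 W7 : MemberY θ.d₆ θ.ℓ₆ θ.hd' θ.hL' θ.b₀ θ.b₁ Mstar → Type} [∀ x, NormedAddCommGroup (E7 x)] [∀ x, InnerProductSpace ℝ (E7 x)] [∀ x, NormedAddCommGroup (F7 x)]
    [∀ x, InnerProductSpace ℝ (F7 x)] [∀ x, NormedAddCommGroup (W7 x)] [∀ x, InnerProductSpace ℝ (W7 x)] [∀ x, FiniteDimensional ℝ (W7 x)]
    (𝔬311 : ∀ x : MemberY θ.d₆ θ.ℓ₆ θ.hd' θ.hL' θ.b₀ θ.b₁ Mstar, Ops311 (bg9Y (Matrix (Fin N) (Fin N) ℂ) (specialUnitaryUnits (Fin N)) x) (E7 x) (F7 x) (W7 x)) (θ311 a311 M311 : ℝ) (ha311 : 0 < a311) (hM311 : 0 < M311)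
    (h311 : ∀ x : MemberY θ.d₆ θ.ℓ₆ θ.hd' θ.hL' θ.b₀ θ.b₁ Mstar, M311 ≤ (geo9Y x).M → ∀ α₀ : ℝ, 0 < α₀ → (geo9Y x).M * α₀ ≤ a311 →
      ∀ U : (bg9Y (Matrix (Fin N) (Fin N) ℂ) (specialUnitaryUnits (Fin N)) x).Cfg, (bg9Y (Matrix (Fin N) (Fin N) ℂ) (specialUnitaryUnits (Fin N)) x).Reg335 c35Y α₀ U → Inputs311 (𝔬311 x) θ311 (geo9Y x).M U)
    (hPD : ∀ x : MemberY θ.d₆ θ.ℓ₆ θ.hd' θ.hL' θ.b₀ θ.b₁ Mstar, ((opsYOfLetters N θ.toStage3Params Mstar 𝔏 𝔈) x).PosDef = PosDefOfOps (𝔬311 x))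
    {X3 Y3 ι3 A3 : MemberY θ.d₆ θ.ℓ₆ θ.hd' θ.hL' θ.b₀ θ.b₁ Mstar → Type} [∀ x, Fintype (X3 x)] [∀ x, DecidableEq (X3 x)] [∀ x, Fintype (Y3 x)] [∀ x, DecidableEq (Y3 x)]
    [∀ x, Fintype (ι3 x)] [∀ x, Fintype (A3 x)]
    (𝔬310 : ∀ x : MemberY θ.d₆ θ.ℓ₆ θ.hd' θ.hL' θ.b₀ θ.b₁ Mstar, Ops310 (geo9Y x) (bg9Y (Matrix (Fin N) (Fin N) ℂ) (specialUnitaryUnits (Fin N)) x) (X3 x) (Y3 x) (ι3 x) (A3 x))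
    (rd310 : ∀ x : MemberY θ.d₆ θ.ℓ₆ θ.hd' θ.hL' θ.b₀ θ.b₁ Mstar, WalkReading310 (geo9Y x) (bg9Y (Matrix (Fin N) (Fin N) ℂ) (specialUnitaryUnits (Fin N)) x) (X3 x) (ι3 x) (A3 x))
    (R310 : MemberY θ.d₆ θ.ℓ₆ θ.hd' θ.hL' θ.b₀ θ.b₁ Mstar → ℝ) (H310 : MemberY θ.d₆ θ.ℓ₆ θ.hd' θ.hL' θ.b₀ θ.b₁ Mstar → Prop) (κ310 : MemberY θ.d₆ θ.ℓ₆ θ.hd' θ.hL' θ.b₀ θ.b₁ Mstar → Sizes310)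
    (d3 : ℕ) (α3 ρ3 N3 N3' NF3 Cℓ3 K3 θ3 B3 δ3 a3 M3 ML3 : ℝ)
    (hα3 : 0 ≤ α3) (hα3' : α3 ≤ 1 / 2) (hN3 : 0 ≤ N3) (hN3' : 0 ≤ N3') (hNF3 : 0 ≤ NF3) (hCℓ3 : 1 ≤ Cℓ3) (hK3 : 0 ≤ K3) (hθ3 : 0 ≤ θ3) (hB3 : 0 < B3)
    (hδ3 : 0 < δ3) (ha3 : 0 < a3) (hM3 : 0 < M3) (hst3 : ∀ x, StaticOK310 (𝔬310 x) ρ3 N3 N3' NF3 Cℓ3 (κ310 x)) (hκ3 : ∀ x, (κ310 x).Bounded K3)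
    (hrd3 : ∀ x, (rd310 x).OK (𝔬310 x).blk) (hloc3 : ∀ x, Locality310 (𝔬310 x) (rd310 x))
    (h261_3 : ∀ x : MemberY θ.d₆ θ.ℓ₆ θ.hd' θ.hL' θ.b₀ θ.b₁ Mstar, ML3 ≤ (geo9Y x).M → Ineq261 d3 (toB6 (geo9Y x) (R310 x) (H310 x)) δ3 α3)
    (h36_3 : ∀ x : MemberY θ.d₆ θ.ℓ₆ θ.hd' θ.hL' θ.b₀ θ.b₁ Mstar, M3 ≤ (geo9Y x).M → ∀ α₀ : ℝ, 0 < α₀ → c35Y * (geo9Y x).M * α₀ ≤ a3 →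
      ∀ U : (bg9Y (Matrix (Fin N) (Fin N) ℂ) (specialUnitaryUnits (Fin N)) x).Cfg, (bg9Y (Matrix (Fin N) (Fin N) ℂ) (specialUnitaryUnits (Fin N)) x).Reg335 c35Y α₀ U →
        Local342G (𝔬310 x) (R310 x) (H310 x) B3 δ3 U ∧ B9Thm310Whole.Factors389 (𝔬310 x) (R310 x) (H310 x) θ3 δ3 U ∧
          Identities310 (𝔬310 x) (R310 x) (H310 x) U)
    (ev3 : ∀ x : MemberY θ.d₆ θ.ℓ₆ θ.hd' θ.hL' θ.b₀ θ.b₁ Mstar, (geo9Y x).Loc → X3 x → ℝ) (evY3 : ∀ x : MemberY θ.d₆ θ.ℓ₆ θ.hd' θ.hL' θ.b₀ θ.b₁ Mstar, (geo9Y x).Loc → Y3 x → ℝ)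
    (hcoA0 : ∀ x U, CoRealizes ((opsYOfLetters N θ.toStage3Params Mstar 𝔏 𝔈) x).GA 0 U (𝔬310 x).blk (𝔬310 x).blk (ev3 x) ((𝔬310 x).G U))
    (hcoA1 : ∀ x U, CoRealizes ((opsYOfLetters N θ.toStage3Params Mstar 𝔏 𝔈) x).GA 1 U (𝔬310 x).blkY (𝔬310 x).blk (ev3 x) ((𝔬310 x).D U ∘ₗ (𝔬310 x).G U))
    (hcoA2 : ∀ x U, CoRealizes ((opsYOfLetters N θ.toStage3Params Mstar 𝔏 𝔈) x).GA 2 U (𝔬310 x).blk (𝔬310 x).blkY (evY3 x) ((𝔬310 x).G U ∘ₗ (𝔬310 x).Dstar U))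
    (hcoA3 : ∀ x U, CoRealizes ((opsYOfLetters N θ.toStage3Params Mstar 𝔏 𝔈) x).GA 3 U (𝔬310 x).blk (𝔬310 x).blk (ev3 x) ((𝔬310 x).Lap U ∘ₗ (𝔬310 x).G U))
    (hglA0 : ∀ x U, GlobReads ((opsYOfLetters N θ.toStage3Params Mstar 𝔏 𝔈) x).GA 0 U (𝔬310 x).blk (𝔬310 x).blk (ev3 x) ((𝔬310 x).G U))
    (hglA1 : ∀ x U, GlobReads ((opsYOfLetters N θ.toStage3Params Mstar 𝔏 𝔈) x).GA 1 U (𝔬310 x).blkY (𝔬310 x).blk (ev3 x) ((𝔬310 x).D U ∘ₗ (𝔬310 x).G U))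
    (hglA2 : ∀ x U, GlobReads ((opsYOfLetters N θ.toStage3Params Mstar 𝔏 𝔈) x).GA 2 U (𝔬310 x).blk (𝔬310 x).blkY (evY3 x) ((𝔬310 x).G U ∘ₗ (𝔬310 x).Dstar U))
    (hglA3 : ∀ x U, GlobReads ((opsYOfLetters N θ.toStage3Params Mstar 𝔏 𝔈) x).GA 3 U (𝔬310 x).blk (𝔬310 x).blk (ev3 x) ((𝔬310 x).Lap U ∘ₗ (𝔬310 x).G U))
    (hlA0 : ∀ x U, L2Reads (R := R310 x) (H := H310 x) ((opsYOfLetters N θ.toStage3Params Mstar 𝔏 𝔈) x).GA 0 U (𝔬310 x).blk (𝔬310 x).blk (ev3 x) ((𝔬310 x).G U))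
    (hlA1 : ∀ x U, L2Reads (R := R310 x) (H := H310 x) ((opsYOfLetters N θ.toStage3Params Mstar 𝔏 𝔈) x).GA 1 U (𝔬310 x).blkY (𝔬310 x).blk (ev3 x) ((𝔬310 x).D U ∘ₗ (𝔬310 x).G U))
    (hlA2 : ∀ x U, L2Reads (R := R310 x) (H := H310 x) ((opsYOfLetters N θ.toStage3Params Mstar 𝔏 𝔈) x).GA 2 U (𝔬310 x).blk (𝔬310 x).blkY (evY3 x) ((𝔬310 x).G U ∘ₗ (𝔬310 x).Dstar U))
    (hsymA : ∀ x U, IsTransposePair ((𝔬310 x).G U) ((𝔬310 x).G U)) (htrA : ∀ x U, IsTransposePair ((𝔬310 x).D U ∘ₗ (𝔬310 x).G U) ((𝔬310 x).G U ∘ₗ (𝔬310 x).Dstar U))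
    {dFA : ℕ} {αFA L₀A MgA MrA arA : ℝ}
    (hfactsA : ∀ x : MemberY θ.d₆ θ.ℓ₆ θ.hd' θ.hL' θ.b₀ θ.b₁ Mstar, MgA ≤ (geo9Y x).M → Facts347 (geo9Y x) (R310 x) (H310 x) dFA ((1 - 2 * α3) * δ3) αFA L₀A)
    (hCB3 : (const37 d3 δ3 α3 ρ3 B3 N3 N3' Cℓ3 K3) ≤ B₁) (hCL3 : (const37 d3 δ3 α3 ρ3 B3 N3 N3' Cℓ3 K3) * L₀A ≤ B₁) (hδ₁le3 : δ₁ ≤ (1 - αFA) * ((1 - 2 * α3) * δ3)) (hαFA : 0 ≤ αFA * ((1 - 2 * α3) * δ3))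
    (hCg3 : (const37 d3 δ3 α3 ρ3 B3 N3 N3' Cℓ3 K3) * B6.c1 dFA ((1 - 2 * α3) * δ3) (1 - αFA) * L₀A ^ (4 : ℝ) ≤ B₁) (harA : 0 < arA)
    (hrestA : ∀ x : MemberY θ.d₆ θ.ℓ₆ θ.hd' θ.hL' θ.b₀ θ.b₁ Mstar, MrA ≤ (geo9Y x).M → ∀ α₀ : ℝ, 0 < α₀ → (geo9Y x).M * α₀ ≤ arA → ∀ U : (bg9Y (Matrix (Fin N) (Fin N) ℂ) (specialUnitaryUnits (Fin N)) x).Cfg, (bg9Y (Matrix (Fin N) (Fin N) ℂ) (specialUnitaryUnits (Fin N)) x).Reg335 c35Y α₀ U →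
      B9.Ineq343_345 ((opsYOfLetters N θ.toStage3Params Mstar 𝔏 𝔈) x).GA Bβ Bε Bεβ δ₁ U ∧
        ∀ (n : Fin 6), 3 ≤ n.val → ∀ (lam : (geo9Y x).Loc) (h : (geo9Y x).Cut) (y y' : (geo9Y x).Site), (geo9Y x).cutIn h y →
          (geo9Y x).suppIn lam y' →
          ((opsYOfLetters N θ.toStage3Params Mstar 𝔏 𝔈) x).GA.l2 n U lam h ≤ B₁ * B9.pref6 ((geo9Y x).len y) n * (geo9Y x).cutSup h *
            Real.exp (-(δ₁ * (geo9Y x).dist y y')) * (geo9Y x).l2Norm lam)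
    (hE310 : ∀ x : MemberY θ.d₆ θ.ℓ₆ θ.hd' θ.hL' θ.b₀ θ.b₁ Mstar, ((opsYOfLetters N θ.toStage3Params Mstar 𝔏 𝔈) x).E310 = W310OfOps (𝔬310 x) (rd310 x) (ConvAll3107 (𝔬310 x) (R310 x) (H310 x) (const37 d3 δ3 α3 ρ3 B3 N3 N3' Cℓ3 K3) ((1 - 2 * α3) * δ3) ((opsYOfLetters N θ.toStage3Params Mstar 𝔏 𝔈) x).GA B₁ δ₁ Bβ Bε Bεβ))
    {Ediff : ∀ x : MemberY θ.d₆ θ.ℓ₆ θ.hd' θ.hL' θ.b₀ θ.b₁ Mstar, B9.RWExpansion (geo9Y x) (bg9Y (Matrix (Fin N) (Fin N) ℂ) (specialUnitaryUnits (Fin N)) x)}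
    {termK : ∀ x : MemberY θ.d₆ θ.ℓ₆ θ.hd' θ.hL' θ.b₀ θ.b₁ Mstar, (Ediff x).Walk → B9.KernelFamily (geo9Y x) (bg9Y (Matrix (Fin N) (Fin N) ℂ) (specialUnitaryUnits (Fin N)) x)}
    (D314 : ∀ x : MemberY θ.d₆ θ.ℓ₆ θ.hd' θ.hL' θ.b₀ θ.b₁ Mstar, B9Thm314.LocData (geo9Y x) (bg9Y (Matrix (Fin N) (Fin N) ℂ) (specialUnitaryUnits (Fin N)) x) (Ediff x)) (L314 : ∀ x, (D314 x).Laws (dOmegaY x)) (r314 : ℝ)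
    (hr314 : ∀ x, (D314 x).diam ≤ r314)
    (hA314 : DiffExpansionAllNorms c35Y geo9Y (bg9Y (Matrix (Fin N) (Fin N) ℂ) (specialUnitaryUnits (Fin N))) Ediff termK (fun x => (D314 x).Touches))
    (hS314 : RWSumFactorYieldsSupL2 geo9Y (bg9Y (Matrix (Fin N) (Fin N) ℂ) (specialUnitaryUnits (Fin N))) Ediff termK (fun x => ((opsYOfLetters N θ.toStage3Params Mstar 𝔏 𝔈) x).Kdiff) OmKY)
    (hH314 : RWSumFactorYieldsHolder geo9Y (bg9Y (Matrix (Fin N) (Fin N) ℂ) (specialUnitaryUnits (Fin N))) Ediff termK (fun x => ((opsYOfLetters N θ.toStage3Params Mstar 𝔏 𝔈) x).Kdiff) OmKY)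
    {𝔸5 : Type} [NormedRing 𝔸5] {P5 W5 : MemberY θ.d₆ θ.ℓ₆ θ.hd' θ.hL' θ.b₀ θ.b₁ Mstar → Type} [∀ x, Fintype (P5 x)]
    (𝔬315 : ∀ x : MemberY θ.d₆ θ.ℓ₆ θ.hd' θ.hL' θ.b₀ θ.b₁ Mstar, Ops315 (geo9Y x) (bg9Y (Matrix (Fin N) (Fin N) ℂ) (specialUnitaryUnits (Fin N)) x) 𝔸5 (P5 x) (W5 x)) {K5 r5 m5 a5 δ5 B5 : ℝ}
    (hK5 : 0 < K5) (hm5 : 0 < m5) (ha5 : 0 < a5) (hδ5 : 0 < δ5) (hB5 : 0 < B5)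
    (hR5 : ∀ x : MemberY θ.d₆ θ.ℓ₆ θ.hd' θ.hL' θ.b₀ θ.b₁ Mstar, Reads315 (𝔬315 x) ((opsYOfLetters N θ.toStage3Params Mstar 𝔏 𝔈) x).Ck (inΛY x) K5) (hS5 : ∀ x : MemberY θ.d₆ θ.ℓ₆ θ.hd' θ.hL' θ.b₀ θ.b₁ Mstar, Static315 (𝔬315 x) (unitDistY x) r5 m5)
    (h315 : ∀ (x : MemberY θ.d₆ θ.ℓ₆ θ.hd' θ.hL' θ.b₀ θ.b₁ Mstar) (α₀ : ℝ), 0 < α₀ → (geo9Y x).M * α₀ ≤ a5 →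
      ∀ U : (bg9Y (Matrix (Fin N) (Fin N) ℂ) (specialUnitaryUnits (Fin N)) x).Cfg, (bg9Y (Matrix (Fin N) (Fin N) ℂ) (specialUnitaryUnits (Fin N)) x).Reg335 c35Y α₀ U → (bg9Y (Matrix (Fin N) (Fin N) ℂ) (specialUnitaryUnits (Fin N)) x).Reg336 c35Y α₀ U →
        GivenBy3185OfOps (𝔬315 x) U ∧ HasRWExpCOfOps (𝔬315 x) (unitDistY x) B5 U δ5)
    (hG315 : ∀ (x : MemberY θ.d₆ θ.ℓ₆ θ.hd' θ.hL' θ.b₀ θ.b₁ Mstar) (U : (bg9Y (Matrix (Fin N) (Fin N) ℂ) (specialUnitaryUnits (Fin N)) x).Cfg), GivenBy3185OfOps (𝔬315 x) U → ((opsYOfLetters N θ.toStage3Params Mstar 𝔏 𝔈) x).GivenBy3185 U)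
    (hH315 : ∀ (x : MemberY θ.d₆ θ.ℓ₆ θ.hd' θ.hL' θ.b₀ θ.b₁ Mstar) (U : (bg9Y (Matrix (Fin N) (Fin N) ℂ) (specialUnitaryUnits (Fin N)) x).Cfg) (δ' : ℝ), HasRWExpCOfOps (𝔬315 x) (unitDistY x) B5 U δ' → ((opsYOfLetters N θ.toStage3Params Mstar 𝔏 𝔈) x).HasRWExpC U δ')
    (r : ℝ)
    (hgeo : ∀ (x : MemberY θ.d₆ θ.ℓ₆ θ.hd' θ.hL' θ.b₀ θ.b₁ Mstar) (y y' : (geo9Y x).Site), ¬ (OmKY x y ∧ OmKY x y') →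
      dOmegaY x y y' ≤ (geo9Y x).dist y y' + r)
    (hplain : ∃ M₁ δ₁ a₁ B₁ : ℝ, 0 < M₁ ∧ 0 < δ₁ ∧ 0 < a₁ ∧ 0 < B₁ ∧
      ∀ x : MemberY θ.d₆ θ.ℓ₆ θ.hd' θ.hL' θ.b₀ θ.b₁ Mstar, M₁ ≤ (geo9Y x).M → ∀ α₀ : ℝ, 0 < α₀ → (geo9Y x).M * α₀ ≤ a₁ →
        ∀ U : (bg9Y (Matrix (Fin N) (Fin N) ℂ) (specialUnitaryUnits (Fin N)) x).Cfg,
          (bg9Y (Matrix (Fin N) (Fin N) ℂ) (specialUnitaryUnits (Fin N)) x).Reg335 c35Y α₀ U → IneqSupF ((opsYOfLetters N θ.toStage3Params Mstar 𝔏 𝔈) x).Kdiff B₁ δ₁ (fun _ => True) (fun _ _ => 1) U)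
    {X12 Y12 Z12 W12 : MemberY θ.d₆ θ.ℓ₆ θ.hd' θ.hL' θ.b₀ θ.b₁ Mstar → Type} [∀ x, Fintype (X12 x)] [∀ x, DecidableEq (X12 x)] [∀ x, Fintype (Y12 x)] [∀ x, Fintype (Z12 x)]
    [∀ x, Fintype (W12 x)]
    (𝔬12 : ∀ x : MemberY θ.d₆ θ.ℓ₆ θ.hd' θ.hL' θ.b₀ θ.b₁ Mstar, B9Thm312Whole.Ops (geo9Y x) (bg9Y (Matrix (Fin N) (Fin N) ℂ) (specialUnitaryUnits (Fin N)) x) (X12 x) (Y12 x) (Z12 x) (W12 x)) (R12 : MemberY θ.d₆ θ.ℓ₆ θ.hd' θ.hL' θ.b₀ θ.b₁ Mstar → ℝ) (H12 : MemberY θ.d₆ θ.ℓ₆ θ.hd' θ.hL' θ.b₀ θ.b₁ Mstar → Prop)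
    (ev12 : ∀ x : MemberY θ.d₆ θ.ℓ₆ θ.hd' θ.hL' θ.b₀ θ.b₁ Mstar, (geo9Y x).Loc → X12 x → ℝ) (evY12 : ∀ x : MemberY θ.d₆ θ.ℓ₆ θ.hd' θ.hL' θ.b₀ θ.b₁ Mstar, (geo9Y x).Loc → Y12 x → ℝ)
    (θ12 r12 B12₀ δ12₀ δK12 σ12 ρ12 a12 M12 B12₁ δ12₁ : ℝ) (Bβ12 Bε12 : ℝ → ℝ) (Bεβ12 : ℝ → ℝ → ℝ)
    (hθ12 : 0 ≤ θ12) (hr12 : 0 ≤ r12) (hB12₀ : 0 ≤ B12₀) (hρ12 : 0 < ρ12) (hρS12 : ρ12 ≤ δ12₀) (hρδ12 : ρ12 + σ12 ≤ δK12) (hσ12 : 0 < σ12)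
    (ha12 : 0 < a12) (hM12 : 0 < M12) (hB12₁ : 0 ≤ B12₁) (hδ12₁ : 0 < δ12₁) (hBβ12 : ∀ β, 0 ≤ Bβ12 β) (hBε12 : ∀ ε, 0 ≤ Bε12 ε) (hBεβ12 : ∀ ε β, 0 ≤ Bεβ12 ε β)
    (hco12 : ∀ (x : MemberY θ.d₆ θ.ℓ₆ θ.hd' θ.hL' θ.b₀ θ.b₁ Mstar) (U : (bg9Y (Matrix (Fin N) (Fin N) ℂ) (specialUnitaryUnits (Fin N)) x).Cfg),
      CoRealizes ((opsYOfLetters N θ.toStage3Params Mstar 𝔏 𝔈) x).GD 0 U (𝔬12 x).blk (𝔬12 x).blk (ev12 x) ((𝔬12 x).G U) ∧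
      CoRealizes ((opsYOfLetters N θ.toStage3Params Mstar 𝔏 𝔈) x).GD 2 U (𝔬12 x).blk (𝔬12 x).blkY (evY12 x) ((𝔬12 x).G U ∘ₗ (𝔬12 x).Dstar U) ∧
      CoRealizes ((opsYOfLetters N θ.toStage3Params Mstar 𝔏 𝔈) x).G₁ 0 U (𝔬12 x).blk (𝔬12 x).blk (ev12 x) ((𝔬12 x).G1 U) ∧
      CoRealizes ((opsYOfLetters N θ.toStage3Params Mstar 𝔏 𝔈) x).G₁ 2 U (𝔬12 x).blk (𝔬12 x).blkY (evY12 x) ((𝔬12 x).G1 U ∘ₗ (𝔬12 x).Dstar U))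
    (hmodel12 : ∀ x : MemberY θ.d₆ θ.ℓ₆ θ.hd' θ.hL' θ.b₀ θ.b₁ Mstar, M12 ≤ (geo9Y x).M → ∀ α₀ : ℝ, 0 < α₀ → (geo9Y x).M * α₀ ≤ a12 →
      ∀ U : (bg9Y (Matrix (Fin N) (Fin N) ℂ) (specialUnitaryUnits (Fin N)) x).Cfg, (bg9Y (Matrix (Fin N) (Fin N) ℂ) (specialUnitaryUnits (Fin N)) x).Reg335 c35Y α₀ U → (bg9Y (Matrix (Fin N) (Fin N) ℂ) (specialUnitaryUnits (Fin N)) x).Reg336 c35Y α₀ U →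
        Thm33G0 (𝔬12 x) (R12 x) (H12 x) B12₀ δ12₀ U ∧
        B9Thm312Whole.Step (𝔬12 x) (R12 x) (H12 x) (fun y => (geo9Y_len_pos x y).le) 1 (θ12 * ((geo9Y x).M * α₀)) δK12 U ∧
        B9Thm312Whole.Step (𝔬12 x) (R12 x) (H12 x) (fun y => (geo9Y_len_pos x y).le) 2 (θ12 * ((geo9Y x).M * α₀)) δK12 U ∧
        FormSmall (𝔬12 x) (r12 * ((geo9Y x).M * α₀)) U ∧ B9Thm312Whole.Identities (𝔬12 x) U)
    (hres12 : ∀ x : MemberY θ.d₆ θ.ℓ₆ θ.hd' θ.hL' θ.b₀ θ.b₁ Mstar, M12 ≤ (geo9Y x).M → ∀ α₀ : ℝ, 0 < α₀ → (geo9Y x).M * α₀ ≤ a12 →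
      ∀ U : (bg9Y (Matrix (Fin N) (Fin N) ℂ) (specialUnitaryUnits (Fin N)) x).Cfg, (bg9Y (Matrix (Fin N) (Fin N) ℂ) (specialUnitaryUnits (Fin N)) x).Reg335 c35Y α₀ U → (bg9Y (Matrix (Fin N) (Fin N) ℂ) (specialUnitaryUnits (Fin N)) x).Reg336 c35Y α₀ U →
        (∀ K ∈ [((opsYOfLetters N θ.toStage3Params Mstar 𝔏 𝔈) x).GD, ((opsYOfLetters N θ.toStage3Params Mstar 𝔏 𝔈) x).G₁], Clause342 K 1 B12₁ δ12₁ U ∧ L2Block K B12₁ δ12₁ U ∧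
          (∀ (n : Fin 4) (lam : (geo9Y x).Loc) (γ : ℝ), n ≠ 3 → -4 ≤ γ → γ ≤ 4 →
            K.glob n U lam γ ≤ B12₁ * (geo9Y x).wNorm γ lam) ∧
          B9.Ineq343_345 K Bβ12 Bε12 Bεβ12 δ12₁ U) ∧
        (∀ Hk' ∈ [((opsYOfLetters N θ.toStage3Params Mstar 𝔏 𝔈) x).H, ((opsYOfLetters N θ.toStage3Params Mstar 𝔏 𝔈) x).H₁], B9.Ineq3133 (θ.d₆ + 1) Hk' B12₁ Bβ12 δ12₁ U))
    (hpinE : ∀ x : MemberY θ.d₆ θ.ℓ₆ θ.hd' θ.hL' θ.b₀ θ.b₁ Mstar, ((opsYOfLetters N θ.toStage3Params Mstar 𝔏 𝔈) x).HasRWExp = HasRWExpOfOps (𝔬12 x))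
    (hpinH : ∀ x : MemberY θ.d₆ θ.ℓ₆ θ.hd' θ.hL' θ.b₀ θ.b₁ Mstar, ((opsYOfLetters N θ.toStage3Params Mstar 𝔏 𝔈) x).HasRWExpH = HasRWExpHOfOps (𝔬12 x))
    (hpinK : ∀ x : MemberY θ.d₆ θ.ℓ₆ θ.hd' θ.hL' θ.b₀ θ.b₁ Mstar, ((opsYOfLetters N θ.toStage3Params Mstar 𝔏 𝔈) x).PosDefK = PosDefKOfOps (𝔬12 x))
    (B13 δ13 ρ13 : ℝ) (hB13 : 0 ≤ B13) (hρ13 : 0 < ρ13) (hρ13ρ : ρ13 + 3 * σ12 ≤ ρ12) (hρδ13 : ρ12 ≤ δ13)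
    (hco13 : ∀ (x : MemberY θ.d₆ θ.ℓ₆ θ.hd' θ.hL' θ.b₀ θ.b₁ Mstar) (U : (bg9Y (Matrix (Fin N) (Fin N) ℂ) (specialUnitaryUnits (Fin N)) x).Cfg),
      CoRealizes ((opsYOfLetters N θ.toStage3Params Mstar 𝔏 𝔈) x).GG 0 U (𝔬12 x).blk (𝔬12 x).blk (ev12 x) ((𝔬12 x).GG U) ∧
      CoRealizes ((opsYOfLetters N θ.toStage3Params Mstar 𝔏 𝔈) x).GG 2 U (𝔬12 x).blk (𝔬12 x).blkY (evY12 x) ((𝔬12 x).GG U ∘ₗ (𝔬12 x).Dstar U))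
    (hletters13 : ∀ x : MemberY θ.d₆ θ.ℓ₆ θ.hd' θ.hL' θ.b₀ θ.b₁ Mstar, M12 ≤ (geo9Y x).M → ∀ α₀ : ℝ, 0 < α₀ → (geo9Y x).M * α₀ ≤ a12 →
      ∀ U : (bg9Y (Matrix (Fin N) (Fin N) ℂ) (specialUnitaryUnits (Fin N)) x).Cfg, (bg9Y (Matrix (Fin N) (Fin N) ℂ) (specialUnitaryUnits (Fin N)) x).Reg335 c35Y α₀ U → (bg9Y (Matrix (Fin N) (Fin N) ℂ) (specialUnitaryUnits (Fin N)) x).Reg336 c35Y α₀ U →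
        Letters313 (𝔬12 x) (R12 x) (H12 x) ⟨geo9Y_dist_triangle x, geo9Y_dist_comm x, geo9K_dist_nonneg x.toKIdx, geo9Y_len_pos x⟩ B13 δ13 U)
    (hres13 : ∀ x : MemberY θ.d₆ θ.ℓ₆ θ.hd' θ.hL' θ.b₀ θ.b₁ Mstar, M12 ≤ (geo9Y x).M → ∀ α₀ : ℝ, 0 < α₀ → (geo9Y x).M * α₀ ≤ a12 →
      ∀ U : (bg9Y (Matrix (Fin N) (Fin N) ℂ) (specialUnitaryUnits (Fin N)) x).Cfg, (bg9Y (Matrix (Fin N) (Fin N) ℂ) (specialUnitaryUnits (Fin N)) x).Reg335 c35Y α₀ U → (bg9Y (Matrix (Fin N) (Fin N) ℂ) (specialUnitaryUnits (Fin N)) x).Reg336 c35Y α₀ U →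
        Clause342 ((opsYOfLetters N θ.toStage3Params Mstar 𝔏 𝔈) x).GG 1 B12₁ δ12₁ U ∧ L2Block ((opsYOfLetters N θ.toStage3Params Mstar 𝔏 𝔈) x).GG B12₁ δ12₁ U ∧
          (∀ (n : Fin 4) (lam : (geo9Y x).Loc) (γ : ℝ), n ≠ 3 → -4 ≤ γ → γ ≤ 4 →
            (((opsYOfLetters N θ.toStage3Params Mstar 𝔏 𝔈) x).GG).glob n U lam γ ≤ B12₁ * (geo9Y x).wNorm γ lam) ∧
          B9.Ineq343_345 ((opsYOfLetters N θ.toStage3Params Mstar 𝔏 𝔈) x).GG Bβ12 Bε12 Bεβ12 δ12₁ U)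
    (hdict : ∀ x : MemberY θ.d₆ θ.ℓ₆ θ.hd' θ.hL' θ.b₀ θ.b₁ Mstar, Dict349 ((opsYOfLetters N θ.toStage3Params Mstar 𝔏 𝔈) x).Gp ((opsYOfLetters N θ.toStage3Params Mstar 𝔏 𝔈) x).Cinv ((opsYOfLetters N θ.toStage3Params Mstar 𝔏 𝔈) x).P349)
    (P : B12.RunParams) : Dag.B9_main (leavesP w P) := by
  have hL1 : (1 : ℝ) ≤ ((θ.ℓ₆ + 1 : ℕ) : ℝ) := by exact_mod_cast Nat.succ_le_succ (Nat.zero_le _)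
  have hη : ∀ x : MemberY θ.d₆ θ.ℓ₆ θ.hd' θ.hL' θ.b₀ θ.b₁ Mstar, 0 < (geo9Y x).eta := fun x => (distOK_geo9Y x).eta_pos
  have hGpG := atOneGlobOn_Gp_opsYOfLetters N θ.toStage3Params Mstar 𝔏 𝔈
  have hGAG : AtOneGlobOn geo9Y (bg9Y (Matrix (Fin N) (Fin N) ℂ) (specialUnitaryUnits (Fin N))) (fun x => ((opsYOfLetters N θ.toStage3Params Mstar 𝔏 𝔈) x).GA) (fun _ lam => lam.isRight = true) :=
    atOneGlobOn_of_atOneEOn (fun x => modelSignsOn_geo9K x.toKIdx) hRGA d21 (L := ((θ.ℓ₆ + 1 : ℕ) : ℝ)) hL1 (fun _ => hL1) (fun _ => le_rfl)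
      hη hL21 hEGA
  have t311 := t311_of_pin θ.toStage3Params Mstar (opsYOfLetters N θ.toStage3Params Mstar 𝔏 𝔈) 𝔬311 θ311 a311 M311 ha311 hM311 h311 hPD
  have t314loc := t314loc_of_leaves θ.toStage3Params Mstar (opsYOfLetters N θ.toStage3Params Mstar 𝔏 𝔈) D314 L314 r314 hr314 hA314 hS314 hH314
  have t315 := t315_of_pins θ.toStage3Params Mstar (opsYOfLetters N θ.toStage3Params Mstar 𝔏 𝔈) 𝔬315 hK5 hm5 ha5 hδ5 hB5 hR5 hS5 h315 hG315 hH315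
  have hGp_e := hGp_e_opsYOfLetters N θ.toStage3Params Mstar 𝔏 𝔈
  have hGp_h1 := hGp_h1_opsYOfLetters N θ.toStage3Params Mstar 𝔏 𝔈
  have hC := hC_opsYOfLetters N θ.toStage3Params Mstar 𝔏 𝔈
  have hGA_e := hGA_e_opsYOfLetters N θ.toStage3Params Mstar 𝔏 𝔈
  have hGA_h1 := hGA_h1_opsYOfLetters N θ.toStage3Params Mstar 𝔏 𝔈
  have hGA_e4 := hGA_e4_opsYOfLetters N θ.toStage3Params Mstar 𝔏 𝔈
  have hGA_h2 := hGA_h2_opsYOfLetters N θ.toStage3Params Mstar 𝔏 𝔈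
  have hGA_l2 := hGA_l2_opsYOfLetters N θ.toStage3Params Mstar 𝔏 𝔈
  have hnullL2 : ∀ (x : MemberY θ.d₆ θ.ℓ₆ θ.hd' θ.hL' θ.b₀ θ.b₁ Mstar) (n : Fin 6) (lam : (geo9Y x).Loc) (h : (geo9Y x).Cut), lam.isRight = true →
      ((opsYOfLetters N θ.toStage3Params Mstar 𝔏 𝔈) x).Gp.l2 n (bg9Y (Matrix (Fin N) (Fin N) ℂ) (specialUnitaryUnits (Fin N)) x).one lam h ≤ 0 := fun x n lam h hlam => by
    cases lam with
    | inl f => exact absurd hlam (by simp)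
    | inr J => cases h <;> exact le_of_eq rfl
  have hnullG : ∀ (x : MemberY θ.d₆ θ.ℓ₆ θ.hd' θ.hL' θ.b₀ θ.b₁ Mstar) (n : Fin 4) (lam : (geo9Y x).Loc) (γ : ℝ), lam.isRight = true →
      ((opsYOfLetters N θ.toStage3Params Mstar 𝔏 𝔈) x).Gp.glob n (bg9Y (Matrix (Fin N) (Fin N) ℂ) (specialUnitaryUnits (Fin N)) x).one lam γ ≤ 0 := fun x n lam γ hlam => by
    cases lam with
    | inl f => exact absurd hlam (by simp)
    | inr J => exact le_of_eq rfl
  have hnullE4 : ∀ (x : MemberY θ.d₆ θ.ℓ₆ θ.hd' θ.hL' θ.b₀ θ.b₁ Mstar) (lam : (geo9Y x).Loc) (y : (geo9Y x).Site), lam.isRight = true →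
      ((opsYOfLetters N θ.toStage3Params Mstar 𝔏 𝔈) x).Gp.e4 (bg9Y (Matrix (Fin N) (Fin N) ℂ) (specialUnitaryUnits (Fin N)) x).one lam y ≤ 0 := fun x lam y hlam => by
    cases lam with
    | inl f => exact absurd hlam (by simp)
    | inr J => exact le_of_eq rfl
  have hnullH2 : ∀ (x : MemberY θ.d₆ θ.ℓ₆ θ.hd' θ.hL' θ.b₀ θ.b₁ Mstar) (lam : (geo9Y x).Loc) (b : ℝ) (ζ : (geo9Y x).Cut), lam.isRight = true →
      ((opsYOfLetters N θ.toStage3Params Mstar 𝔏 𝔈) x).Gp.h2 (bg9Y (Matrix (Fin N) (Fin N) ℂ) (specialUnitaryUnits (Fin N)) x).one lam b ζ ≤ 0 := fun x lam b ζ hlam => by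
    cases lam with
    | inl f => exact absurd hlam (by simp)
    | inr J => cases ζ <;> exact le_of_eq rfl
  have hGp := hGp_of_blocksOn_of_null (opsYOfLetters N θ.toStage3Params Mstar 𝔏 𝔈) hGp_h1 hnullL2 hnullG hnullE4 hnullH2 hGpL2 hGpG hGpH1 hGpE4 hGpH2
  have hGA := hGA_of_globOn_of_null (opsYOfLetters N θ.toStage3Params Mstar 𝔏 𝔈) (hnullGA_opsYOfLetters N θ.toStage3Params Mstar 𝔏 𝔈) hGAG
  have t39 := t39_of_pin θ.toStage3Params Mstar (opsYOfLetters N θ.toStage3Params Mstar 𝔏 𝔈) 𝔬39 rd39 R39 H39 α39 α' r39 δ39 θ39 B39 N39 a39 M39 ML39 h39α h39α1 hα' hr39 hrδ39 hδ39 hθ39 hB39 hN39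
    ha39 hM39 hst39 hloc39 h261_39 h39 hEK39
  have hksum := hksum_of_pin θ.toStage3Params Mstar (opsYOfLetters N θ.toStage3Params Mstar 𝔏 𝔈) 𝔬39 rd39 hEK39 hB₁39 hδ₁39 hrdC
  have s3132 := s3132_of_inputs θ.toStage3Params Mstar (opsYOfLetters N θ.toStage3Params Mstar 𝔏 𝔈) hCT hCT₁ hN32 hN32₁ hA32 hwt
  have hgeoOK : ∀ x : MemberY θ.d₆ θ.ℓ₆ θ.hd' θ.hL' θ.b₀ θ.b₁ Mstar, GeoOK (geo9Y x) := fun x => ⟨geo9Y_dist_triangle x, geo9Y_dist_comm x, geo9K_dist_nonneg x.toKIdx, geo9Y_len_pos x⟩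
  obtain ⟨ML12, c12, hrow12⟩ := rowSum261_geo9Y (d := θ.d₆) (ℓ := θ.ℓ₆) (hd := θ.hd') (hL := θ.hL') (b₀ := θ.b₀) (b₁ := θ.b₁) (Mstar := Mstar) σ12 hσ12
  have hrow : ∀ x : MemberY θ.d₆ θ.ℓ₆ θ.hd' θ.hL' θ.b₀ θ.b₁ Mstar, ML12 ≤ (geo9Y x).M → RowSum (toB6 (geo9Y x) (R12 x) (H12 x)) σ12 (max c12 0) :=
    fun x hM y => (hrow12 x hM y).trans (le_max_left _ _)
  have hE : (fun x => ((opsYOfLetters N θ.toStage3Params Mstar 𝔏 𝔈) x).HasRWExp) = fun x => HasRWExpOfOps (𝔬12 x) := funext hpinE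
  have hH : (fun x => ((opsYOfLetters N θ.toStage3Params Mstar 𝔏 𝔈) x).HasRWExpH) = fun x => HasRWExpHOfOps (𝔬12 x) := funext hpinH
  have hK' : (fun x => ((opsYOfLetters N θ.toStage3Params Mstar 𝔏 𝔈) x).PosDefK) = fun x => PosDefKOfOps (𝔬12 x) := funext hpinK
  have t312 : B9.Thm312Printed (θ.d₆ + 1) c35Y geo9Y (bg9Y (Matrix (Fin N) (Fin N) ℂ) (specialUnitaryUnits (Fin N))) (fun x => ((opsYOfLetters N θ.toStage3Params Mstar 𝔏 𝔈) x).GD) (fun x => ((opsYOfLetters N θ.toStage3Params Mstar 𝔏 𝔈) x).G₁)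
      (fun x => ((opsYOfLetters N θ.toStage3Params Mstar 𝔏 𝔈) x).H) (fun x => ((opsYOfLetters N θ.toStage3Params Mstar 𝔏 𝔈) x).H₁) (fun x => ((opsYOfLetters N θ.toStage3Params Mstar 𝔏 𝔈) x).HasRWExp) (fun x => ((opsYOfLetters N θ.toStage3Params Mstar 𝔏 𝔈) x).HasRWExpH)
      (fun x => ((opsYOfLetters N θ.toStage3Params Mstar 𝔏 𝔈) x).PosDefK) := by
    rw [hE, hH, hK']
    exact thm312Printed_of_step 𝔬12 R12 H12 (fun x => ((opsYOfLetters N θ.toStage3Params Mstar 𝔏 𝔈) x).GD) (fun x => ((opsYOfLetters N θ.toStage3Params Mstar 𝔏 𝔈) x).G₁) (fun x => ((opsYOfLetters N θ.toStage3Params Mstar 𝔏 𝔈) x).H)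
      (fun x => ((opsYOfLetters N θ.toStage3Params Mstar 𝔏 𝔈) x).H₁) ev12 evY12 θ12 r12 B12₀ δ12₀ δK12 σ12 (max c12 0) ρ12 a12 M12 ML12 B12₁ δ12₁ Bβ12 Bε12 Bεβ12 hθ12 hr12 hB12₀ hρ12 hρS12
      hρδ12 (le_max_right _ _) ha12 hM12 hB12₁ hδ12₁ hBβ12 hBε12 hBεβ12 hgeoOK (fun x => modelSignsOn_geo9K x.toKIdx) hrow hco12 hmodel12 hres12
  have t313 : B9.Thm313Printed c35Y geo9Y (bg9Y (Matrix (Fin N) (Fin N) ℂ) (specialUnitaryUnits (Fin N))) (fun x => ((opsYOfLetters N θ.toStage3Params Mstar 𝔏 𝔈) x).GG) (fun x => ((opsYOfLetters N θ.toStage3Params Mstar 𝔏 𝔈) x).HasRWExp) (fun x => ((opsYOfLetters N θ.toStage3Params Mstar 𝔏 𝔈) x).PosDefK) := by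
    rw [hE, hK']
    exact thm313Printed_of_step 𝔬12 R12 H12 (fun x => ((opsYOfLetters N θ.toStage3Params Mstar 𝔏 𝔈) x).GG) ev12 evY12 θ12 r12 B12₀ δ12₀ δK12 σ12 (max c12 0) ρ12 a12 M12 ML12 B12₁ δ12₁ B13
      δ13 ρ13 Bβ12 Bε12 Bεβ12 hθ12 hr12 hB12₀ hB13 hσ12.le hρ13 hρ13ρ hρS12 hρδ13 hρδ12 (le_max_right _ _) ha12 hM12 hB12₁ hδ12₁ hBβ12 hBε12 hBεβ12 hgeoOK
      (fun x => modelSignsOn_geo9K x.toKIdx) hrow hco13 hmodel12 hletters13 hres13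
  have hE4 := hE4_of_hGA_e4 (opsYOfLetters N θ.toStage3Params Mstar 𝔏 𝔈) hGA_e4
  have hH2 := hH2_of_hGA_h2 (opsYOfLetters N θ.toStage3Params Mstar 𝔏 𝔈) hGA_h2
  have hB := hB_obligation_of_memberSteps θ.toStage3Params Mstar (opsYOfLetters N θ.toStage3Params Mstar 𝔏 𝔈) hA hEp hLp hGlp hH1p hE4p hH2p hK hEa hLa hGla hH1a hE4a hH2a
  have hg := hg_obligation_vacuous θ.toStage3Params Mstar (opsYOfLetters N θ.toStage3Params Mstar 𝔏 𝔈)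
  have t37 := t37_of_allPin θ.toStage3Params Mstar (opsYOfLetters N θ.toStage3Params Mstar 𝔏 𝔈) 𝔬 rd R H κ d α ρ Nc N' Cℓ K θ₀ B₀ δ₀ a₁ M₁ ML hα hα2 hN hN' hCℓ hK0 hB₀.le hδ₀.le ha₁ hM₁
    hst hκ h261 h36 (fun x => (rd x).ev) evY hco0 hco1 hco2 hco3 hgl0 hgl1 hgl2 hgl3 hl0 hl1 hl2 hsym htr hfacts hCB hCL hδ₁le hαF hCg har hrest hE37
  have hα1 : α < 1 := by linarith
  have c38 := c38_of_allPin θ.toStage3Params Mstar (opsYOfLetters N θ.toStage3Params Mstar 𝔏 𝔈) 𝔬 rd R H κ d α ρ Nc N' Cℓ K θ₀ B₀ δ₀ a₁ M₁ ML hα hα1 hθ₀ hB₀ hδ₀ ha₁ hM₁ hst hκ hrd hloc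
    h261 h36 hE37
  have t310 := t310_of_allPin θ.toStage3Params Mstar (opsYOfLetters N θ.toStage3Params Mstar 𝔏 𝔈) 𝔬310 rd310 R310 H310 κ310 d3 α3 ρ3 N3 N3' NF3 Cℓ3 K3 θ3 B3 δ3 a3 M3 ML3 hα3 hα3' hN3 hN3' hNF3
    hCℓ3 hK3 hθ3 hB3 hδ3 ha3 hM3 hst3 hκ3 hrd3 hloc3 h261_3 h36_3 ev3 evY3 hcoA0 hcoA1 hcoA2 hcoA3 hglA0 hglA1 hglA2 hglA3 hlA0 hlA1 hlA2 hsymA htrA hfactsA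
    hCB3 hCL3 hδ₁le3 hαFA hCg3 harA hrestA hE310
  have hsum := hsum_of_allPins θ.toStage3Params Mstar (opsYOfLetters N θ.toStage3Params Mstar 𝔏 𝔈) 𝔬 rd R H (const37 d δ₀ α ρ B₀ Nc N' Cℓ K) ((1 - 2 * α) * δ₀) 𝔬310 rd310 R310 H310 (const37 d3 δ3 α3 ρ3 B3 N3 N3' Cℓ3 K3) ((1 - 2 * α3) * δ3) Bβ Bε Bεβ hB₁ hδ₁ hE37 hE310
  have t314 := t314_obligation_of_t314loc θ.toStage3Params Mstar (opsYOfLetters N θ.toStage3Params Mstar 𝔏 𝔈) r hgeo t314loc hplain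
  have h31 := B9.thm31_of_thm37 c35Y geo9Y (bg9Y (Matrix (Fin N) (Fin N) ℂ) (specialUnitaryUnits (Fin N))) (fun x => ((opsYOfLetters N θ.toStage3Params Mstar 𝔏 𝔈) x).E37) (fun x => ((opsYOfLetters N θ.toStage3Params Mstar 𝔏 𝔈) x).E310) (fun x => ((opsYOfLetters N θ.toStage3Params Mstar 𝔏 𝔈) x).Gp)
    (fun x => ((opsYOfLetters N θ.toStage3Params Mstar 𝔏 𝔈) x).GA) t37 hsum
  have h32 := B9.thm32_of_thm39 (θ.d₆ + 1) c35Y geo9Y (bg9Y (Matrix (Fin N) (Fin N) ℂ) (specialUnitaryUnits (Fin N))) (fun x => ((opsYOfLetters N θ.toStage3Params Mstar 𝔏 𝔈) x).EK39) (fun x => ((opsYOfLetters N θ.toStage3Params Mstar 𝔏 𝔈) x).Cinv) t39 hksum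
  have s349 : B9.Stmt349Printed (θ.d₆ + 1) c35Y geo9Y (bg9Y (Matrix (Fin N) (Fin N) ℂ) (specialUnitaryUnits (Fin N))) (fun x => ((opsYOfLetters N θ.toStage3Params Mstar 𝔏 𝔈) x).P349) :=
    stmt349Printed_of_thm31_thm32 (geo := geo9Y) (bg := (bg9Y (Matrix (Fin N) (Fin N) ℂ) (specialUnitaryUnits (Fin N)))) (θ.d₆ + 1) h31 h32 (Q := fun _ lam => lam.isRight = true)
      (fun x => modelSignsOn_geo9K x.toKIdx) (fun x => distOK_geo9Y x) hL1 (fun _ => rfl) one_pos levelGap_geo9Y_one rowSum261_geo9Y hdict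
  exact b9_main_of_up_view₁₁B10YZW_of_obligations θ hθ Mstar (opsYOfLetters N θ.toStage3Params Mstar 𝔏 𝔈) ζ lamW w hup hGp_e hGp_h1 hC hGA_e hGA_h1 hGA_e4 hGA_h2 hGA_l2 hE4 hH2 hGp hGA hB
    hg t37 c38 t39 t310 hsum hksum t311 t312 t313 t314 t315 s349 s3132 t314loc P

end Pointed

end Summit.QuantumFields.YangMills.BalabanUVNodes.N06AtOpsYOfLettersAllPins

end
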